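import Summits.BirchSwinnertonDyer.BirchSwinnertonDyer.Theorems.ErratumRoadFiveIMCDivOneSidedCongruenceLeDefs
import HarnessLib

/-!
# Route `ErratumRoadFive`, crux `IMCDivAtErratumDataAll` (item stmt-BirchSwinnertonDyer-19270):
# Road FF INPUT CUT of the one-sided congruence package — three NAMED datum-level predicates
# (member supply ∕ member divisibility ∕ value congruence) and their PROVED recombination

Cell `bsd-stepL` (run/shared/lean/pub/bsd-stepL/), seat `bsd-stepL-imc-p1` (prover, session g8), task t1 of
planner g29 RULING 1/3 (STATUS 2026-08-27T02:01Z); `--supports stmt-BirchSwinnertonDyer-19270 --as helper`.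

The package of record `P2.OneSidedCongruenceDataLeAt W p κ 𝔭 γ ι f` (imc24b g3,
`Theorems/ErratumRoadFiveIMCDivOneSidedCongruenceLeDefs.lean`) is ONE existential over the data
`(Ω_K, Ω_p, L, Σ, P_Σ, L^Σ, (N_m)_m, (L_m)_m)` with eleven conjuncts. This file CUTS it along the three
sources the erratum's proof [Castella2018Erratum, proof of Thm. 1.1, p. 4] draws on, so that each source
becomes ONE named predicate at the datum `(W, p, κ, 𝔭, γ, ι, f)`:

* `P2.RoadFF.MemberSupplyAt W p κ 𝔭 γ S PS Mem` — the ALGEBRAIC side: `Σ` finite with `X^Σ_ac(E)`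
  `Λ`-torsion [CTL], the `Σ`-Euler comparison `P_Σ ≠ 0`, `Ch(X^∅)·(P_Σ) ⊆ Ch(X^Σ)` [Cas18 (3.1), algebraic
  half], and for every `m ≥ 1` a MEMBER `(N_m, L_m)` satisfying the member predicate `Mem m N_m L_m` with
  `N_m` finitely generated and `X^Σ/p^m ≅ N_m/p^m` [Erratum (b) + Lemma 2.1; Hida theory supplies `g_m`];
* `P2.RoadFF.MemberDivisibilityAt p Mem` — for every member `(N, L_N)` with `N` torsion,
  `Ch_Λ(N)·R₀⟦T⟧ ⊆ (L_N)` [Erratum (2.5)_m = FW21 Thm. 4.41 at the crystalline member; the DECIDING input];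
* `P2.RoadFF.ValueCongruenceLeAt p κ 𝔭 γ ι f PS Mem` — the ANALYTIC side: an `R₀`-frame `(Ω_K, Ω_p, L)` for
  `f` [Cas18 Thm. 3.1], `L·P_Σ ∣ L^Σ` [Cas18 (3.1), analytic half] and the one-sided congruences
  `(L_m) ⊆ (L^Σ) + (p)^m` for every member [Cas18 (4.1) + `ν_{g_m} ≡ ν_f`, Erratum (c)].

The three predicates share exactly the datum-level parameters `Σ = S`, `P_Σ = PS` and the MEMBER PREDICATE
`Mem : ℕ → ModuleCat Λ → R₀⟦T⟧ → Prop` ("`(N, L_N)` is (the `Λ`-currency Selmer dual, the `Σ`-imprimitive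
`p`-adic `L`-function) of the `m`-th crystalline Hida member `g_m ≡ f mod p^m`"). `Mem` is a PARAMETER here:
typing it concretely is the typer's fact F2 (Hida members, `bsd-stepL-defn-ty1` objects `OrdinaryNewformDatum.
cofreeRepOver ∕ bigRep`, `BigGaloisRep.XBig`), and — as flagged on the cell bus (imc-p1 02:02Z, defn-ty1 02:04Z)
— the members' coefficient rings `𝒪 ⊋ ℤ_p` mean that proving `MemberSupplyAt` ∕ `MemberDivisibilityAt` for the
concrete `Mem` from GALOIS-level facts (F1 `Castella2018.SkinnerUrban2014.prop323_XAc_equiv_XBigDecomp`, F4 =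
FW21 4.41 on `XBig κ (Δ.cofreeRepOver K) 𝔭 Σ` over `𝒪⟦T⟧`) passes through a COEFFICIENT BRIDGE (norm
`Λ_𝒪 → Λ` of characteristic ideals, or `Sel(M ⊗ 𝒪) ≅ Sel(M) ⊗ 𝒪` with
`Literature.NumberTheory.GaloisRepresentations.ContinuousRep.extendScalars`); that bridge lives INSIDE the
proofs of those two predicates, not in this cut, whose module currency is `Λ = ℤ_p⟦T⟧` throughout (matching
the package of record VERBATIM).

PROVED here: `P2.oneSidedCongruenceDataLeAt_of_roadFF` (the three predicates ⟹ the package, by regrouping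
conjuncts) and `P2.exists_roadFF_of_oneSidedCongruenceDataLeAt` (the package ⟹ the three predicates for
SOME `(S, PS, Mem)` — nothing is lost), and the composite to the crux's datum-level conclusion
`P2.exists_intCoreFrame_of_roadFF`. Shapes assert nothing; the theorems are unconditional regroupings.
-/

set_option autoImplicit false

noncomputable section

open scoped Classical

open WeierstrassCurve NumberField IsDedekindDomain Field PowerSeries
open Literature.NumberTheory.EllipticCurves Literature.NumberTheory.EllipticCurves.GreenbergSelmer
  Literature.NumberTheory.EllipticCurves.ModularForms Literature.NumberTheory.EllipticCurves.Rank1Residual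
  Literature.NumberTheory.EllipticCurves.Rank1Residual.Typed Literature.NumberTheory.EllipticCurves.Castella2018
  Literature.NumberTheory.EllipticCurves.Module Literature.NumberTheory.GaloisRepresentations
  Literature.NumberTheory.GaloisCohomology Literature.RingTheory.FittingIdeal
open Summit.BirchSwinnertonDyer.Rank1Residual.X11b.AcSelmer Summit.BirchSwinnertonDyer.Rank1Residual.X11b.Halves

namespace Summit.BirchSwinnertonDyer.Rank1Residual.X11b

section Shapes

variable {K : Type} [Field K] [NumberField K] (W : WeierstrassCurve ℚ) (p : ℕ) [Fact p.Prime]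
  (κ : ZpExtension K p) (𝔭 : HeightOneSpectrum (𝓞 K)) (γ : Field.absoluteGaloisGroup K)
  [Fact (κ.IsTopGenerator γ)] (ι : PadicAlgCl p ≃+* ℂ) {N : ℕ}
  (f : CuspForm (CongruenceSubgroup.Gamma0 N) 2)
  (S : Set (HeightOneSpectrum (𝓞 K))) (PS : IwasawaAlgebra p)
  (Mem : ℕ → ModuleCat.{0} (IwasawaAlgebra p) → UnrSeries p → Prop)

/-- **ROAD FF, MEMBER SUPPLY AT A DATUM (shape; asserts nothing)** — the algebraic side of the one-sided
congruence package for the member predicate `Mem`, the finite set `S = Σ` and the `Σ`-Euler element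
`PS = P_Σ`: `Σ` finite with `X^Σ_ac(E/K)` `Λ`-torsion [CTL]; `P_Σ ≠ 0` and `Ch(X^∅)·(P_Σ) ⊆ Ch(X^Σ)`
[Cas18 (3.1), algebraic half]; members `(N_m, L_m)` for all `m` (`N_m` finitely generated `Λ`-modules in
`ModuleCat Λ`), and for `m ≥ 1`: `Mem m N_m L_m` and a `Λ`-isomorphism `X^Σ/p^m ≅ N_m/p^m`
[Erratum (b) + Lemma 2.1]. Module currency `Λ = ℤ_p⟦T⟧` = that of `P2.OneSidedCongruenceDataLeAt`; the
coefficient bridge from the members' `𝒪⟦T⟧`-modules lives inside any PROOF of this predicate for a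
concrete `Mem`, not here. A predicate; NEVER a theorem in this cell.
[claim: Castella2018Erratum, status: under-review]
[cite: Castella2018Erratum, (b), Lemma 2.1, proof of Thm. 1.1 (pp. 2–4) (shape only; nothing asserted)]
[cite: Castella2018, (3.1) (arXiv:1704.06608 p. 9) (shape only; nothing asserted)] -/
@[conjecture]
def P2.RoadFF.MemberSupplyAt : Prop :=
  S.Finite ∧ Module.IsTorsion (IwasawaAlgebra p) (XAc (W.baseChange K) p κ 𝔭 S γ) ∧
    PS ≠ 0 ∧ XAc.charIdeal (W.baseChange K) p κ 𝔭 ∅ γ * Ideal.span {PS} ≤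
      XAc.charIdeal (W.baseChange K) p κ 𝔭 S γ ∧
    ∃ (Nm : ℕ → ModuleCat.{0} (IwasawaAlgebra p)) (Lm : ℕ → UnrSeries p),
      (∀ m : ℕ, Module.Finite (IwasawaAlgebra p) (Nm m)) ∧
      ∀ m : ℕ, 1 ≤ m → Mem m (Nm m) (Lm m) ∧ Nonempty
        ((XAc (W.baseChange K) p κ 𝔭 S γ ⧸
            ((Ideal.span {(PowerSeries.C (p : ℤ_[p]) : IwasawaAlgebra p)}) ^ m •
              (⊤ : Submodule (IwasawaAlgebra p) (XAc (W.baseChange K) p κ 𝔭 S γ)))) ≃ₗ[IwasawaAlgebra p]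
          ((Nm m) ⧸ ((Ideal.span {(PowerSeries.C (p : ℤ_[p]) : IwasawaAlgebra p)}) ^ m •
            (⊤ : Submodule (IwasawaAlgebra p) (Nm m)))))

/-- **ROAD FF, MEMBER DIVISIBILITY (shape; asserts nothing)** — for every `m ≥ 1` and every member
`(N, L_N)` of the member predicate `Mem` with `N` `Λ`-torsion: `Ch_Λ(N)·R₀⟦T⟧ ⊆ (L_N)` [Erratum (2.5)_m —
one divisibility of the IMC for the crystalline member `g_m`, Fouquet–Wan Thm. 4.41 at `p ∥ N`, PREPRINT;
the DECIDING input of Road FF]. For the concrete Hida-member predicate this is where FW21 4.41 on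
`BigGaloisRep.XBig κ (Δ.cofreeRepOver K) 𝔭 Σ` (over `𝒪⟦T⟧`), the unramified-outside-`Σ` identification
`Castella2018.SkinnerUrban2014.prop323_XAc_equiv_XBigDecomp` and the coefficient bridge `𝒪⟦T⟧ → Λ` are
consumed. A predicate; NEVER a theorem in this cell.
[claim: Castella2018Erratum, status: under-review]
[cite: Castella2018Erratum, (2.5) and proof of Thm. 1.1 (p. 4) (shape only; nothing asserted)]
[cite: FouquetWan2021, Thm. 4.41 (shape only; nothing asserted)] -/
@[conjecture]
def P2.RoadFF.MemberDivisibilityAt : Prop :=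
  ∀ m : ℕ, 1 ≤ m → ∀ (Nm : ModuleCat.{0} (IwasawaAlgebra p)) (Lm : UnrSeries p), Mem m Nm Lm →
    Module.IsTorsion (IwasawaAlgebra p) Nm →
      (Module.charIdeal (IwasawaAlgebra p) Nm).map (PowerSeries.map (toUnr p)) ≤ Ideal.span {Lm}

/-- **ROAD FF, VALUE CONGRUENCES, ONE-SIDED (shape; asserts nothing)** — the analytic side for the member
predicate `Mem` and the `Σ`-Euler element `PS = P_Σ`: an `R₀`-frame `(Ω_K ≠ 0, Ω_p ∈ R₀ˣ, L)` with
`IsBDPLFunction ι 𝔭 κ γ f Ω_K Ω_p L` [Cas18 Thm. 3.1]; a `Σ`-imprimitive `L^Σ` with `L·P_Σ ∣ L^Σ` [Cas18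
(3.1), the half the descent uses]; and for every `m ≥ 1` and every member `(N, L_m)`: the INCLUSION
`(L_m) ⊆ (L^Σ) + (p)^m` [Cas18 (4.1) + `ν_{g_m} ≡ ν_f mod p^m`, Erratum (c), read one-sidedly]. A predicate;
NEVER a theorem in this cell.
[claim: Castella2018Erratum, status: under-review]
[cite: Castella2018Erratum, (c) and proof of Thm. 1.1 (p. 4) (shape only; nothing asserted)]
[cite: Castella2018, Thm. 3.1, (3.1), (4.1) (arXiv:1704.06608 pp. 9, 11) (shape only; nothing asserted)] -/
@[conjecture]
def P2.RoadFF.ValueCongruenceLeAt : Prop :=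
  ∃ (ΩK : ℂ) (Ωp : (unrIntegers p)ˣ) (L LS : UnrSeries p),
    ΩK ≠ 0 ∧ IsBDPLFunction ι 𝔭 κ γ f ΩK ((Ωp : unrIntegers p) : ℂ_[p]) L ∧
    L * PowerSeries.map (toUnr p) PS ∣ LS ∧
    ∀ m : ℕ, 1 ≤ m → ∀ (Nm : ModuleCat.{0} (IwasawaAlgebra p)) (Lm : UnrSeries p), Mem m Nm Lm →
      Ideal.span {Lm} ≤
        Ideal.span {LS} ⊔ (Ideal.span {(PowerSeries.C ((p : ℕ) : unrIntegers p) : UnrSeries p)}) ^ m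

variable {W p κ 𝔭 γ ι f S PS Mem}

/-- **THE RECOMBINATION: member supply ∧ member divisibility ∧ one-sided value congruences ⟹ the
one-sided congruence package of record `P2.OneSidedCongruenceDataLeAt W p κ 𝔭 γ ι f`** — a regrouping of
conjuncts (the members supplied by `MemberSupplyAt` are fed to the two `∀`-predicates). Unconditional.
[cite: Castella2018Erratum, proof of Thm. 1.1 (p. 4), read one-sidedly] -/
theorem P2.oneSidedCongruenceDataLeAt_of_roadFF
    (hsup : P2.RoadFF.MemberSupplyAt W p κ 𝔭 γ S PS Mem)
    (hdiv : P2.RoadFF.MemberDivisibilityAt p Mem)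
    (hval : P2.RoadFF.ValueCongruenceLeAt p κ 𝔭 γ ι f PS Mem) :
    P2.OneSidedCongruenceDataLeAt W p κ 𝔭 γ ι f := by
  obtain ⟨hS, hT, hPS, hX, Nm, Lm, hfin, hmem⟩ := hsup
  obtain ⟨ΩK, Ωp, L, LS, hΩ, hL, hLS, hc⟩ := hval
  exact ⟨ΩK, Ωp, L, S, PS, LS, Nm, Lm, hΩ, hL, hS, hT, hPS, hX, hLS, hfin,
    fun m hm ↦ (hmem m hm).2,
    fun m hm hNt ↦ hdiv m hm (Nm m) (Lm m) (hmem m hm).1 hNt,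
    fun m hm ↦ hc m hm (Nm m) (Lm m) (hmem m hm).1⟩

/-- **NOTHING IS LOST: the package of record ⟹ the three Road FF predicates for SOME `(Σ, P_Σ, Mem)`**
(take `Mem m N L :↔ N = N_m ∧ L = L_m` for the package's own members). Unconditional.
[cite: Castella2018Erratum, proof of Thm. 1.1 (p. 4)] -/
theorem P2.exists_roadFF_of_oneSidedCongruenceDataLeAt
    (h : P2.OneSidedCongruenceDataLeAt W p κ 𝔭 γ ι f) :
    ∃ (S : Set (HeightOneSpectrum (𝓞 K))) (PS : IwasawaAlgebra p)
      (Mem : ℕ → ModuleCat.{0} (IwasawaAlgebra p) → UnrSeries p → Prop),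
      P2.RoadFF.MemberSupplyAt W p κ 𝔭 γ S PS Mem ∧ P2.RoadFF.MemberDivisibilityAt p Mem ∧
        P2.RoadFF.ValueCongruenceLeAt p κ 𝔭 γ ι f PS Mem := by
  obtain ⟨ΩK, Ωp, L, S, PS, LS, Nm, Lm, hΩ, hL, hS, hT, hPS, hX, hLS, hfin, he, hF, hc⟩ := h
  refine ⟨S, PS, fun m N L' ↦ N = Nm m ∧ L' = Lm m, ⟨hS, hT, hPS, hX, Nm, Lm, hfin,
    fun m hm ↦ ⟨⟨rfl, rfl⟩, he m hm⟩⟩, ?_, ⟨ΩK, Ωp, L, LS, hΩ, hL, hLS, ?_⟩⟩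
  · rintro m hm N L' ⟨rfl, rfl⟩ hNt
    exact hF m hm hNt
  · rintro m hm N L' ⟨rfl, rfl⟩
    exact hc m hm

/-- **At a datum: the three Road FF predicates ⟹ the ♭-frame conjunct of crux 19270**
(`P2.exists_intCoreFrame_of_oneSidedCongruenceDataLeAt` after the recombination). Unconditional in the
three predicates; closes nothing by itself.
[cite: Castella2018Erratum, (2.4) and proof of Thm. 1.1 (p. 4)] -/
theorem P2.exists_intCoreFrame_of_roadFF [W.IsElliptic]
    (hsup : P2.RoadFF.MemberSupplyAt W p κ 𝔭 γ S PS Mem)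
    (hdiv : P2.RoadFF.MemberDivisibilityAt p Mem)
    (hval : P2.RoadFF.ValueCongruenceLeAt p κ 𝔭 γ ι f PS Mem) :
    ∃ (ΩK : ℂ) (Ωp : ℂ_[p]) (Q : PowerSeries 𝓞_ℂ_[p]), ΩK ≠ 0 ∧ ‖Ωp‖ = 1 ∧
      R1.IsBDPLFunctionInt p ι 𝔭 κ γ f ΩK Ωp Q ∧
      (XAc.charIdeal (W.baseChange K) p κ 𝔭 ∅ γ).map (PowerSeries.map (R1.toCpInt p)) ≤
        Ideal.span {Q} :=
  P2.exists_intCoreFrame_of_oneSidedCongruenceDataLeAt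
    (P2.oneSidedCongruenceDataLeAt_of_roadFF hsup hdiv hval)

end Shapes

end Summit.BirchSwinnertonDyer.Rank1Residual.X11b

end
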